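import Literature.Probability.RandomPlanarGeometry.WholePlaneLoewnerCurve
import HarnessLib

/-!
# Gluing local radial pieces into a whole-plane Loewner curve

Topic `Probability/RandomPlanarGeometry`; theorems only (no definition, no named fact). Sequel of
`WholePlaneLoewnerCurve` (the deterministic skeleton of Miller–Sheffield (2013), proof of
Prop. 2.5). There the whole-plane chain was shown to be generated by a curve from radial pieces
which, from every base time `b` of a set unbounded below, describe the chain for **all** later
times. The radial theory of a random driving function, however, describes the chain only **locally
in time** — from the base time `b` up to a horizon `b + h_b` (the first exit of an angle from a
band, capped): `RadialSLE.ae_locallyGenerated`. This file glues such local pieces: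

* `WholePlaneLoewnerChain.markov_tower` — the **tower property** of the Markovian description of
  the hulls: if `ℂ ∖ K_b` is the unbounded component of `ℂ ∖ (γ[a, b] ∪ K_a)` and `ℂ ∖ K_c` that of
  `ℂ ∖ (γ[b, c] ∪ K_b)`, then `ℂ ∖ K_c` is the unbounded component of `ℂ ∖ (γ[a, c] ∪ K_a)`;
* `WholePlaneLoewnerChain.markov_of_base` — the description from an arbitrary base time inside a
  piece (monotonicity in the base time, `compl_hull_eq_unboundedComponent_mono`);
* `WholePlaneLoewnerChain.isCurve_of_local_pieces` — **`IsCurve` from local pieces**: if every time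
  lies strictly inside a piece `(b, b + h_b)` on which a continuous candidate curve avoids `K_b` and
  satisfies the radial domain identity of `compl_hull_eq_unboundedComponent_of_disc`, and the
  candidates are the values of one two-sided path `γ`, then `C.IsCurve γ` (Lebesgue number lemma
  on `[T, t]`, a finite chain of pieces, the tower property, and `isCurve_of_forall_lt`).

## References

* J. Miller, S. Sheffield, *Imaginary geometry IV: interior rays, whole-plane reversibility, and
  space-filling trees*, Probab. Theory Related Fields 169 (2017), arXiv:1302.4738, Prop. 2.5
  (proof). [MillerSheffield2013]
* G. F. Lawler, *Conformally Invariant Processes in the Plane*, AMS (2005), §4.3, §6.6.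
  [Lawler2005]
-/

noncomputable section

open Set Filter Topology Metric Complex
open scoped NNReal

namespace Literature.Probability.RandomPlanarGeometry

/-- **The unbounded component is saturated**: the component of a point of `unboundedComponent U`
in `U` lies in `unboundedComponent U`. [folklore] -/
theorem Loewner.connectedComponentIn_subset_unboundedComponent {U : Set ℂ} {z : ℂ}
    (hz : z ∈ Loewner.unboundedComponent U) : connectedComponentIn U z ⊆ Loewner.unboundedComponent U := by
  intro y hy
  refine ⟨connectedComponentIn_subset _ _ hy, fun hbdd ↦ hz.2 ?_⟩
  rwa [connectedComponentIn_eq hy]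

namespace WholePlaneLoewnerChain

variable {lam : ℝ → ℝ}

/-- Points of a curve piece described from the base `a` lie in the later hull. [folklore] -/
theorem image_subset_hull_of_markov (C : WholePlaneLoewnerChain lam) {γ : ℝ → ℂ} {a b : ℝ} {J : Set ℝ}
    (h : (C.hull b)ᶜ = Loewner.unboundedComponent (γ '' J ∪ C.hull a)ᶜ) : γ '' J ⊆ C.hull b := by
  rintro _ ⟨s, hs, rfl⟩
  by_contra hnot
  have hmem : γ s ∈ Loewner.unboundedComponent (γ '' J ∪ C.hull a)ᶜ := h ▸ hnot
  exact (Loewner.unboundedComponent_subset _ hmem) (Or.inl ⟨s, hs, rfl⟩)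

/-- **Tower property of the Markovian description.** [cite: MillerSheffield2013, Prop. 2.5 (proof)] -/
theorem markov_tower (C : WholePlaneLoewnerChain lam) {γ : ℝ → ℂ} {a b c : ℝ} (hab : a ≤ b) (hbc : b ≤ c)
    (h₁ : (C.hull b)ᶜ = Loewner.unboundedComponent (γ '' Icc a b ∪ C.hull a)ᶜ)
    (h₂ : (C.hull c)ᶜ = Loewner.unboundedComponent (γ '' Icc b c ∪ C.hull b)ᶜ) :
    (C.hull c)ᶜ = Loewner.unboundedComponent (γ '' Icc a c ∪ C.hull a)ᶜ := by
  set V₁ : Set ℂ := (γ '' Icc a b ∪ C.hull a)ᶜ with hV₁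
  set V₂ : Set ℂ := (γ '' Icc b c ∪ C.hull b)ᶜ with hV₂
  set V : Set ℂ := (γ '' Icc a c ∪ C.hull a)ᶜ with hV
  have hγb : γ '' Icc a b ⊆ C.hull b := C.image_subset_hull_of_markov h₁
  have hγc : γ '' Icc b c ⊆ C.hull c := C.image_subset_hull_of_markov h₂
  have hbc' : C.hull b ⊆ C.hull c := C.hull_mono hbc
  have hQV : (C.hull c)ᶜ ⊆ V := by
    rw [hV, compl_subset_compl]
    rintro z (⟨s, hs, rfl⟩ | hz)
    · rcases le_total s b with hsb | hbs
      · exact hbc' (hγb ⟨s, ⟨hs.1, hsb⟩, rfl⟩)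
      · exact hγc ⟨s, ⟨hbs, hs.2⟩, rfl⟩
    · exact C.hull_mono (hab.trans hbc) hz
  refine eq_unboundedComponent_of_saturated hQV (C.isConnected_compl_hull _).isPreconnected
    (by simpa using C.isBounded_hull c) (C.not_isBounded_compl_hull _) fun z hz ↦ ?_
  set P := connectedComponentIn V z with hP
  have hPV : P ⊆ V := connectedComponentIn_subset _ _
  have hzP : z ∈ P := mem_connectedComponentIn (hQV hz)
  have hPconn : IsPreconnected P := isPreconnected_connectedComponentIn
  -- Step 1: `P ⊆ ℂ ∖ K_b`
  have hPV₁ : P ⊆ V₁ := by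
    refine hPV.trans (compl_subset_compl.2 ?_)
    rintro x (⟨s, hs, rfl⟩ | hx)
    · exact Or.inl ⟨s, ⟨hs.1, hs.2.trans hbc⟩, rfl⟩
    · exact Or.inr hx
  have hzb : z ∈ (C.hull b)ᶜ := fun h ↦ hz (hbc' h)
  have hPb : P ⊆ (C.hull b)ᶜ := by
    have h1 : P ⊆ connectedComponentIn V₁ z := hPconn.subset_connectedComponentIn hzP hPV₁
    rw [h₁] at hzb ⊢
    exact h1.trans (Loewner.connectedComponentIn_subset_unboundedComponent hzb)
  -- Step 2: `P ⊆ ℂ ∖ K_c`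
  have hPV₂ : P ⊆ V₂ := by
    intro x hx
    rintro (⟨s, hs, hsx⟩ | hxb)
    · exact hPV hx (Or.inl ⟨s, ⟨hab.trans hs.1, hs.2⟩, hsx⟩)
    · exact hPb hx hxb
  have h1 : P ⊆ connectedComponentIn V₂ z := hPconn.subset_connectedComponentIn hzP hPV₂
  have hz' : z ∈ Loewner.unboundedComponent V₂ := h₂ ▸ hz
  rw [h₂]
  exact h1.trans (Loewner.connectedComponentIn_subset_unboundedComponent hz')

/-- **The Markovian description from any base time inside a piece.** If from the base `b` the
description holds at the times `b + u` and `b + u'` (`u ≤ u'`) with the open-closed curve piece,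
and `γ(s) ∈ K_s` along the piece, then it holds from the base `b + u` at time `b + u'` with the
closed piece `γ[b + u, b + u']`. [cite: MillerSheffield2013, Prop. 2.5 (proof)] -/
theorem markov_of_base (C : WholePlaneLoewnerChain lam) {γ : ℝ → ℂ} {b T t : ℝ} (hbT : b < T) (hTt : T ≤ t)
    (hγK : ∀ s ∈ Ioc b T, γ s ∈ C.hull s)
    (ht : (C.hull t)ᶜ = Loewner.unboundedComponent (γ '' Ioc b t ∪ C.hull b)ᶜ) :
    (C.hull t)ᶜ = Loewner.unboundedComponent (γ '' Icc T t ∪ C.hull T)ᶜ := by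
  have hγt : γ '' Ioc b t ⊆ C.hull t := C.image_subset_hull_of_markov ht
  refine C.compl_hull_eq_unboundedComponent_mono ht ?_ ?_
  · rintro z (⟨s, hs, rfl⟩ | hz)
    · rcases lt_or_ge s T with hsT | hTs
      · exact Or.inr (C.hull_mono hsT.le (hγK s ⟨hs.1, hsT.le⟩))
      · exact Or.inl ⟨s, ⟨hTs, hs.2⟩, rfl⟩
    · exact Or.inr (C.hull_mono hbT.le hz)
  · rintro z (⟨s, hs, rfl⟩ | hz)
    · exact hγt ⟨s, ⟨hbT.trans_le hs.1, hs.2⟩, rfl⟩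
    · exact C.hull_mono hTt hz

/-- **`IsCurve` from local radial pieces.** Let `γ : ℝ → ℂ` be continuous and suppose every time
`t` lies strictly inside a piece `(b, b + h)` on which `γ` avoids `K_b` and the radial Loewner
domain of the shifted driver `u ↦ -λ(b + u)` at each time `u < h` is the component of `0` in
`𝔻 ∖ (1/g_b ∘ γ)((b, b + u])`. Then `C` is generated by `γ` (`IsCurve`): the pieces give the
Markovian description of the hulls locally (`compl_hull_eq_unboundedComponent_of_disc`,
`markov_of_base`), a finite chain of pieces along `[T, t]` (Lebesgue number lemma) and the tower
property (`markov_tower`) give it from every base time, and `isCurve_of_forall_lt` concludes.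
[cite: MillerSheffield2013, Prop. 2.5 (proof)] -/
theorem isCurve_of_local_pieces (C : WholePlaneLoewnerChain lam) (hlam : Continuous lam) {γ : ℝ → ℂ}
    (hγ : Continuous γ)
    (hpiece : ∀ t : ℝ, ∃ b h : ℝ, b < t ∧ t < b + h ∧ (∀ s ∈ Ioo b (b + h), γ s ∉ C.hull b) ∧
      ∀ u : ℝ≥0, 0 < u → (u : ℝ) < h →
        RadialLoewner.Disc.domain (WholePlaneLoewner.shiftDriver lam b) u =
          connectedComponentIn (ball (0 : ℂ) 1 \ (fun s ↦ (C.map b (γ s))⁻¹) '' Ioc b (b + u)) 0) :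
    C.IsCurve γ := by
  -- Step A: the open-closed description inside a piece
  have hA : ∀ {b h t : ℝ}, (∀ s ∈ Ioo b (b + h), γ s ∉ C.hull b) →
      (∀ u : ℝ≥0, 0 < u → (u : ℝ) < h →
        RadialLoewner.Disc.domain (WholePlaneLoewner.shiftDriver lam b) u =
          connectedComponentIn (ball (0 : ℂ) 1 \ (fun s ↦ (C.map b (γ s))⁻¹) '' Ioc b (b + u)) 0) →
      b < t → t < b + h → (C.hull t)ᶜ = Loewner.unboundedComponent (γ '' Ioc b t ∪ C.hull b)ᶜ := by
    intro b h t hN hG hbt hth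
    set u : ℝ≥0 := ⟨t - b, by linarith⟩ with hu
    have hupos : 0 < u := by rw [← NNReal.coe_pos]; show 0 < t - b; linarith
    have huh : (u : ℝ) < h := by show t - b < h; linarith
    have ht : b + u = t := by show b + (t - b) = t; ring
    rw [← ht]
    exact C.compl_hull_eq_unboundedComponent_of_disc hlam
      (fun s hs ↦ hN s ⟨hs.1, lt_of_le_of_lt hs.2 (by rw [ht]; exact hth)⟩) (hG u hupos huh)
  -- Step B: every point of the curve lies in the hull of its time
  have hγK : ∀ s : ℝ, γ s ∈ C.hull s := by
    intro s
    obtain ⟨b, h, hbs, hsh, hN, hG⟩ := hpiece s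
    by_contra hnot
    have hmem : γ s ∈ Loewner.unboundedComponent (γ '' Ioc b s ∪ C.hull b)ᶜ := hA hN hG hbs hsh ▸ hnot
    exact (Loewner.unboundedComponent_subset _ hmem) (Or.inl ⟨s, ⟨hbs, le_rfl⟩, rfl⟩)
  -- Step C: `γ(t) → 0` as `t → -∞`
  have h0 : Tendsto γ atBot (𝓝 0) := by
    refine tendsto_nhds.2 fun U hU h0U ↦ ?_
    obtain ⟨T₀, hT₀⟩ := (C.eventually_hull_subset (hU.mem_nhds h0U)).exists_forall_of_atBot
    exact eventually_atBot.2 ⟨T₀, fun s hs ↦ hT₀ s hs (hγK s)⟩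
  -- Step D: the closed description from any base inside a piece
  have hD : ∀ {b h T t : ℝ}, (∀ s ∈ Ioo b (b + h), γ s ∉ C.hull b) →
      (∀ u : ℝ≥0, 0 < u → (u : ℝ) < h →
        RadialLoewner.Disc.domain (WholePlaneLoewner.shiftDriver lam b) u =
          connectedComponentIn (ball (0 : ℂ) 1 \ (fun s ↦ (C.map b (γ s))⁻¹) '' Ioc b (b + u)) 0) →
      b < T → T ≤ t → t < b + h → (C.hull t)ᶜ = Loewner.unboundedComponent (γ '' Icc T t ∪ C.hull T)ᶜ :=
    fun hN hG hbT hTt hth ↦ C.markov_of_base hbT hTt (fun s _ ↦ hγK s) (hA hN hG (hbT.trans_le hTt) hth)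
  -- the description from a base time at itself
  have hself : ∀ T : ℝ, (C.hull T)ᶜ = Loewner.unboundedComponent (γ '' Icc T T ∪ C.hull T)ᶜ := by
    intro T
    have hset : γ '' Icc T T ∪ C.hull T = C.hull T := by
      rw [Icc_self, image_singleton, union_eq_right, singleton_subset_iff]; exact hγK T
    rw [hset]
    exact eq_unboundedComponent_of_saturated Subset.rfl (C.isConnected_compl_hull _).isPreconnected
      (by simpa using C.isBounded_hull T) (C.not_isBounded_compl_hull _)
      (fun z _ ↦ connectedComponentIn_subset _ _)
  -- Step E: the description from every base time `T < t`
  refine C.isCurve_of_forall_lt hγ h0 fun T t hTt ↦ ?_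
  choose bf hf hpf using hpiece
  have hcover : Icc T t ⊆ ⋃ x : ℝ, Ioo (bf x) (bf x + hf x) := fun x _ ↦
    mem_iUnion.2 ⟨x, (hpf x).1, (hpf x).2.1⟩
  obtain ⟨δ, hδ, hδcov⟩ := lebesgue_number_lemma_of_metric isCompact_Icc (fun _ ↦ isOpen_Ioo) hcover
  -- a grid of mesh `< δ`
  obtain ⟨m, hm⟩ := exists_nat_gt ((t - T) / δ)
  have hmpos : (0 : ℝ) < m := lt_of_le_of_lt (div_nonneg (by linarith) hδ.le) hm
  have hm0 : (m : ℝ) ≠ 0 := hmpos.ne'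
  set d : ℝ := (t - T) / m with hd
  have hd0 : 0 ≤ d := div_nonneg (by linarith) hmpos.le
  have hdδ : d < δ := by
    rw [hd, div_lt_iff₀ hmpos]
    calc t - T = (t - T) / δ * δ := by field_simp
      _ < m * δ := mul_lt_mul_of_pos_right hm hδ
      _ = δ * m := mul_comm _ _
  set g : ℕ → ℝ := fun i ↦ T + i * d with hg
  have hg0 : g 0 = T := by simp [hg]
  have hgm : g m = t := by
    simp only [hg, hd]; field_simp; ring
  have hgmono : ∀ i, g i ≤ g (i + 1) := fun i ↦ by
    simp only [hg]; push_cast; nlinarith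
  have hgT : ∀ i, T ≤ g i := fun i ↦ by
    simp only [hg]; nlinarith [i.cast_nonneg (α := ℝ)]
  have hgle : ∀ i, i ≤ m → g i ≤ t := by
    intro i hi
    rw [← hgm]
    simp only [hg]
    have : (i : ℝ) ≤ m := by exact_mod_cast hi
    nlinarith
  -- induction along the grid
  have hind : ∀ i : ℕ, i ≤ m → (C.hull (g i))ᶜ = Loewner.unboundedComponent (γ '' Icc T (g i) ∪ C.hull T)ᶜ := by
    intro i
    induction i with
    | zero => intro _; rw [hg0]; exact hself T
    | succ i ih =>
      intro hi
      have hi' : i ≤ m := (Nat.le_succ i).trans hi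
      have h1 := ih hi'
      -- the piece around `g i`
      have hmem : g i ∈ Icc T t := ⟨hgT i, hgle i hi'⟩
      obtain ⟨x, hx⟩ := hδcov (g i) hmem
      have hgi : g i ∈ Ioo (bf x) (bf x + hf x) := hx (mem_ball_self hδ)
      have hgi1 : g (i + 1) ∈ Ioo (bf x) (bf x + hf x) := by
        refine hx (mem_ball.2 ?_)
        rw [Real.dist_eq, abs_of_nonneg (by linarith [hgmono i])]
        calc g (i + 1) - g i = d := by simp only [hg]; push_cast; ring
          _ < δ := hdδ
      have h2 : (C.hull (g (i + 1)))ᶜ = Loewner.unboundedComponent (γ '' Icc (g i) (g (i + 1)) ∪ C.hull (g i))ᶜ :=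
        hD (hpf x).2.2.1 (hpf x).2.2.2 hgi.1 (hgmono i) hgi1.2
      exact C.markov_tower (hgT i) (hgmono i) h1 h2
  have h := hind m le_rfl
  rwa [hgm] at h

end WholePlaneLoewnerChain

end Literature.Probability.RandomPlanarGeometry
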